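import Summits.QuantumFields.YangMills.Theorems.PoincareLipschitzTowerGuards
import Literature.MathematicalPhysics.QuantumFieldTheory.Balaban1983to89.T4AxialGaugeSmallField
import HarnessLib

/-!
# Crux stmt-QuantumFields-19936 `HistoryTailL` — THE HIERARCHICAL ALIGNMENT AT THE CRUX'S WINDOWS, scaled torus geometry («ALIGN-T3», part 1)

Cell `ym3-torus` (YM ladder rung R3 = continuum SU(2) Yang–Mills on the three-torus — a RUNG, NOT the Clay problem; not d = 4, not
infinite volume, not a mass gap), width seat `ym-ust-19936-w3` gen 12, `--supports stmt-QuantumFields-19936 --as helper`.  LEAD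
★w1-19936 g7 word 01:07:50Z «ALIGN GO».  Bookkeeping for ✓`PoincareLipschitzHierAlignT3` (companion file): the scaled torus geometry of the
`T3Family` towers — level-`i` sites read at level `0` as `x·L^i`, the letters of hStab's windows (✓`PoincareLipschitzTowerGuards`):

* `val_scaled`, `scaled_sub`, ★ `tdist_scaled_eq` — THE SCALING IS AN ISOMETRY UP TO THE FACTOR `L^i`: `tdist (z·L^i) (w·L^i) = L^i·tdist z w`
  (`N₀ = N_i·L^i`, ✓`sitesPerDir_zero_eq_mul_pow`);
* `tdist_scaled_blockOf_le` — a site is within `3(L−1)L^i` of its block; `tdist_blockTower_le` — hence a level-`0` site is within `3(L^i − 1)` of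
  its whole block tower `y 0 = x`, `y (t+1) = blockOf (y t)`;
* `tdist_le_three_of_near` (`ℓ^∞`-`1` neighbours are within torus distance `3`), `tdist_add_intCast_le'` ∕ `tdist_castSite_add_le` (translates),
  `exists_int_rep_of_tdist_le` (integer representatives of coarse sites within `T` of a centre `castSite A`, inside the cube `[A − T, A + T]`).

THEOREMS ONLY, def-free, route-independent lattice kinematics (`d = 3`); nothing of h⋆, F5∕F6, `BlockLipschitzL`, the stubs of any registered
line, the crux `HistoryTailL` or a summit statement is proved here.
-/

noncomputable section

open scoped BigOperators

namespace Summit.QuantumFields.YangMills.Theorems.PoincareLipschitzHierAlignT3Geometry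

open Literature.MathematicalPhysics.QuantumFieldTheory.Balaban1983to89
open Literature.MathematicalPhysics.QuantumFieldTheory.Balaban1983to89.T3ContinuumYM3Torus
open Literature.MathematicalPhysics.QuantumFieldTheory.Balaban1983to89.T3UnitLawDensityEML
open T4Continuum BlockAveraging ExpMeanLog T3UnitScaleTilt
open Literature.MathematicalPhysics.QuantumFieldTheory.Balaban1983to89.B3Taylor310LocalRemainder (tdist_triangle tdist_comm tdist_self)
open Summit.QuantumFields.YangMills.Theorems.PoincareLipschitzIteratedOfAvgStability (sitesPerDir_zero_eq_mul_pow)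
open T4AxialGaugeSmallField (castSite castSite_apply boxPlaqs axialGauge dist1_gaugeAct_axialGauge_le_uniform)
open B7Prop1Explicit (e e_apply)

variable {F : T3Family} {K : ℕ}

/-! ## §1 Scaled torus geometry of the `T3Family` towers -/

section Geometry

/-- The label of a scaled coordinate: `((c·L^i : ℕ) : ℤ∕N₀).val = c·L^i` for `c < N_i` (no wrap: `N₀ = N_i·L^i`). [folklore] -/
theorem val_scaled {i : ℕ} (hi : i ≤ F.m + K) (c : ℕ) (hc : c < (F.P K).sitesPerDir i) :
    ((((c * F.L ^ i : ℕ)) : ZMod ((F.P K).sitesPerDir 0))).val = c * F.L ^ i := by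
  rw [ZMod.val_natCast, Nat.mod_eq_of_lt]
  rw [sitesPerDir_zero_eq_mul_pow F K hi]
  exact Nat.mul_lt_mul_of_lt_of_le hc le_rfl (pow_pos (by have := F.hL.2; omega) i)

/-- Scaling is additive: `(z − w)·L^i = z·L^i − w·L^i` in `ℤ∕N₀`. [folklore] -/
theorem scaled_sub {i : ℕ} (hi : i ≤ F.m + K) (z w : Site (F.P K) i) (k : Fin (F.P K).d) :
    (((((z k).val * F.L ^ i : ℕ)) : ZMod ((F.P K).sitesPerDir 0))) - ((((w k).val * F.L ^ i : ℕ)) : ZMod ((F.P K).sitesPerDir 0)) =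
      ((((z k - w k).val * F.L ^ i : ℕ)) : ZMod ((F.P K).sitesPerDir 0)) := by
  rw [sub_eq_iff_eq_add, ← Nat.cast_add, ← add_mul]
  refine (ZMod.natCast_eq_natCast_iff _ _ _).mpr ?_
  rw [sitesPerDir_zero_eq_mul_pow F K hi]
  refine Nat.ModEq.mul_right' _ ?_
  -- `z.val ≡ (z − w).val + w.val (mod N_i)`
  have h : ((z k - w k) + w k).val = ((z k - w k).val + (w k).val) % (F.P K).sitesPerDir i := ZMod.val_add _ _
  rw [sub_add_cancel] at h
  rw [Nat.ModEq, h, Nat.mod_mod]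

/-- ★ **SCALING IS AN ISOMETRY UP TO `L^i`**: `tdist (z·L^i) (w·L^i) = L^i · tdist z w` (level `i ≤ m + K` read at level `0`). [folklore] -/
theorem tdist_scaled_eq {i : ℕ} (hi : i ≤ F.m + K) (z w : Site (F.P K) i) :
    Site.tdist (fun k => ((((z k).val * F.L ^ i : ℕ)) : ZMod ((F.P K).sitesPerDir 0)))
        (fun k => ((((w k).val * F.L ^ i : ℕ)) : ZMod ((F.P K).sitesPerDir 0))) = F.L ^ i * Site.tdist z w := by
  unfold Site.tdist
  rw [Finset.mul_sum]
  refine Finset.sum_congr rfl fun k _ => ?_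
  rw [scaled_sub hi z w k, scaled_sub hi w z k, val_scaled hi _ (ZMod.val_lt (z k - w k)), val_scaled hi _ (ZMod.val_lt (w k - z k))]
  rcases le_total (z k - w k).val (w k - z k).val with h | h
  · rw [min_eq_left h, min_eq_left (Nat.mul_le_mul_right _ h), mul_comm]
  · rw [min_eq_right h, min_eq_right (Nat.mul_le_mul_right _ h), mul_comm]

/-- **A SITE IS WITHIN `3(L−1)·L^i` OF ITS BLOCK** (scaled reading; `d = 3`): `tdist (x·L^i) ((blockOf x)·L^{i+1}) ≤ 3(L−1)L^i`. [folklore] -/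
theorem tdist_scaled_blockOf_le {i : ℕ} (hi : i + 1 ≤ F.m + K) (x : Site (F.P K) i) :
    Site.tdist (fun k => ((((x k).val * F.L ^ i : ℕ)) : ZMod ((F.P K).sitesPerDir 0)))
        (fun k => ((((blockOf x k).val * F.L ^ (i + 1) : ℕ)) : ZMod ((F.P K).sitesPerDir 0))) ≤ 3 * ((F.L - 1) * F.L ^ i) := by
  have hd : (F.P K).d = 3 := rfl
  have hL0 : 0 < F.L := by have := F.hL.2; omega
  unfold Site.tdist
  calc ∑ k : Fin (F.P K).d, min ((((((x k).val * F.L ^ i : ℕ)) : ZMod ((F.P K).sitesPerDir 0)) -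
            ((((blockOf x k).val * F.L ^ (i + 1) : ℕ)) : ZMod ((F.P K).sitesPerDir 0))).val)
          ((((((blockOf x k).val * F.L ^ (i + 1) : ℕ)) : ZMod ((F.P K).sitesPerDir 0)) -
            ((((x k).val * F.L ^ i : ℕ)) : ZMod ((F.P K).sitesPerDir 0))).val)
      ≤ ∑ _k : Fin (F.P K).d, (F.L - 1) * F.L ^ i := by
        refine Finset.sum_le_sum fun k _ => ?_
        refine (min_le_left _ _).trans ?_
        have hq : (blockOf x k).val = (x k).val / F.L := Site.val_blockOf (P := F.P K) hi x k
        have hdm : (x k).val / F.L * F.L + (x k).val % F.L = (x k).val := Nat.div_add_mod' _ _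
        have e1 : ((((x k).val * F.L ^ i : ℕ)) : ZMod ((F.P K).sitesPerDir 0)) =
            ((((blockOf x k).val * F.L ^ (i + 1) : ℕ)) : ZMod ((F.P K).sitesPerDir 0)) +
              ((((x k).val % F.L * F.L ^ i : ℕ)) : ZMod ((F.P K).sitesPerDir 0)) := by
          rw [← Nat.cast_add, hq]
          congr 1
          conv_lhs => rw [← hdm]
          rw [pow_succ]; ring
        rw [e1, add_sub_cancel_left, ZMod.val_natCast]
        refine (Nat.mod_le _ _).trans ?_
        exact Nat.mul_le_mul_right _ (by have := Nat.mod_lt ((x k).val) hL0; omega)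
    _ = 3 * ((F.L - 1) * F.L ^ i) := by rw [Finset.sum_const, Finset.card_univ, Fintype.card_fin, hd, smul_eq_mul]

/-- At level `0` the scaled reading is the site itself. [folklore] -/
theorem scaled_zero (x : Site (F.P K) 0) :
    (fun k => ((((x k).val * F.L ^ 0 : ℕ)) : ZMod ((F.P K).sitesPerDir 0))) = x := by
  funext k; rw [pow_zero, mul_one, ZMod.natCast_zmod_val]

/-- ★ **A LEVEL-`0` SITE IS WITHIN `3(L^i − 1)` OF ITS WHOLE BLOCK TOWER**: for a tower `y 0 = x`, `y (t+1) = blockOf (y t)` and `i ≤ m + K`,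
`tdist x ((y i)·L^i) ≤ 3(L^i − 1)`. [folklore] -/
theorem tdist_blockTower_le (y : (i : ℕ) → Site (F.P K) i) (hy : ∀ i, y (i + 1) = blockOf (y i)) :
    ∀ i : ℕ, i ≤ F.m + K →
      Site.tdist (y 0) (fun k => ((((y i k).val * F.L ^ i : ℕ)) : ZMod ((F.P K).sitesPerDir 0))) ≤ 3 * (F.L ^ i - 1)
  | 0, _ => by rw [scaled_zero, tdist_self]; simp
  | i + 1, hi => by
    have h1 := tdist_blockTower_le y hy i (by omega)
    have h2 := tdist_scaled_blockOf_le (F := F) (K := K) hi (y i)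
    rw [← hy i] at h2
    have h3 := tdist_triangle (y 0) (fun k => ((((y i k).val * F.L ^ i : ℕ)) : ZMod ((F.P K).sitesPerDir 0)))
      (fun k => ((((y (i + 1) k).val * F.L ^ (i + 1) : ℕ)) : ZMod ((F.P K).sitesPerDir 0)))
    have hL1 : 1 ≤ F.L := by have := F.hL.2; omega
    have hLi : 1 ≤ F.L ^ i := Nat.one_le_pow _ _ hL1
    have e : 3 * (F.L ^ i - 1) + 3 * ((F.L - 1) * F.L ^ i) = 3 * (F.L ^ (i + 1) - 1) := by
      zify [hL1, hLi, Nat.one_le_pow (i + 1) F.L hL1]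
      rw [pow_succ]; ring
    omega

/-- Coarse sites within `ℓ^∞`-distance `1` of each other coordinatewise are within torus distance `d = 3`. [folklore] -/
theorem tdist_le_three_of_near {i : ℕ} (z w : Site (F.P K) i) (hz : ∀ k, z k = w k ∨ z k = w k + 1 ∨ z k = w k - 1) :
    Site.tdist z w ≤ 3 := by
  have hd : (F.P K).d = 3 := rfl
  have hN1 : 1 < (F.P K).sitesPerDir i := (F.P K).one_lt_sitesPerDir i
  haveI : Fact (1 < (F.P K).sitesPerDir i) := ⟨hN1⟩
  unfold Site.tdist
  calc ∑ k : Fin (F.P K).d, min (z k - w k).val (w k - z k).val ≤ ∑ _k : Fin (F.P K).d, 1 := by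
        refine Finset.sum_le_sum fun k _ => ?_
        rcases hz k with h | h | h
        · rw [h, sub_self, ZMod.val_zero]; exact (min_le_left _ _).trans (by norm_num)
        · refine (min_le_left _ _).trans ?_
          rw [h, add_sub_cancel_left, ZMod.val_one]
        · refine (min_le_right _ _).trans ?_
          rw [h, sub_sub_cancel, ZMod.val_one]
    _ = 3 := by rw [Finset.sum_const, Finset.card_univ, Fintype.card_fin, hd, smul_eq_mul, mul_one]

/-- The torus distance from `y + t` to `y` is at most `Σ_κ |t_κ|` (integer vector `t`; any level). [folklore] -/
theorem tdist_add_intCast_le' {i : ℕ} (y T : Site (F.P K) i) (t : Fin (F.P K).d → ℤ)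
    (hT : ∀ κ, T κ = ((t κ : ℤ) : ZMod ((F.P K).sitesPerDir i))) :
    Site.tdist (y + T) y ≤ ∑ κ, (t κ).natAbs := by
  unfold Site.tdist
  refine Finset.sum_le_sum fun κ _ => ?_
  have e1 : (y + T) κ - y κ = ((t κ : ℤ) : ZMod ((F.P K).sitesPerDir i)) := by
    rw [Site.add_apply, hT]; ring
  have e2 : y κ - (y + T) κ = ((-t κ : ℤ) : ZMod ((F.P K).sitesPerDir i)) := by
    rw [Site.add_apply, hT]; push_cast; ring
  rw [e1, e2]
  rcases le_or_gt 0 (t κ) with h | h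
  · refine (min_le_left _ _).trans ?_
    have : ((t κ : ℤ) : ZMod ((F.P K).sitesPerDir i)) = (((t κ).natAbs : ℕ) : ZMod ((F.P K).sitesPerDir i)) := by
      rw [← Int.cast_natCast, Int.natAbs_of_nonneg h]
    rw [this, ZMod.val_natCast]
    exact Nat.mod_le _ _
  · refine (min_le_right _ _).trans ?_
    have : ((-t κ : ℤ) : ZMod ((F.P K).sitesPerDir i)) = (((t κ).natAbs : ℕ) : ZMod ((F.P K).sitesPerDir i)) := by
      rw [← Int.cast_natCast, Int.ofNat_natAbs_of_nonpos h.le]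
    rw [this, ZMod.val_natCast]
    exact Nat.mod_le _ _

/-- **INTEGER REPRESENTATIVES NEAR A CENTRE**: if `tdist y a ≤ T` and `a = castSite A`, then `y = castSite x` for an integer vector `x` with
`A − T ≤ x ≤ A + T` coordinatewise. [folklore] -/
theorem exists_int_rep_of_tdist_le {i : ℕ} (y a : Site (F.P K) i) (A : Fin (F.P K).d → ℤ) (hA : a = castSite A) {T : ℕ}
    (hT : Site.tdist y a ≤ T) :
    ∃ x : Fin (F.P K).d → ℤ, (castSite x : Site (F.P K) i) = y ∧ ∀ k, A k - T ≤ x k ∧ x k ≤ A k + T := by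
  have hcoord : ∀ k, min (y k - a k).val (a k - y k).val ≤ T := by
    intro k
    refine le_trans ?_ hT
    unfold Site.tdist
    exact Finset.single_le_sum (f := fun k => min (y k - a k).val (a k - y k).val) (fun _ _ => Nat.zero_le _) (Finset.mem_univ k)
  refine ⟨fun k => if (y k - a k).val ≤ T then A k + (y k - a k).val else A k - (a k - y k).val, ?_, fun k => ?_⟩
  · funext k
    rw [castSite_apply]
    have ha : a k = ((A k : ℤ) : ZMod ((F.P K).sitesPerDir i)) := by rw [hA, castSite_apply]
    split_ifs with h
    · push_cast; rw [← ha, ZMod.natCast_zmod_val]; ring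
    · push_cast; rw [← ha, ZMod.natCast_zmod_val]; ring
  · have h := hcoord k
    by_cases hc : (y k - a k).val ≤ T
    · simp only [hc, if_true]
      constructor <;> omega
    · simp only [hc, if_false]
      have h2 : (a k - y k).val ≤ T := by
        rw [min_le_iff] at h; omega
      constructor <;> omega

/-- Translates of a `castSite` point: `castSite (A + t) = castSite A + t` and `tdist (castSite (A + t)) (castSite A) ≤ Σ_k |t_k|`. [folklore] -/
theorem tdist_castSite_add_le {i : ℕ} (A t : Fin (F.P K).d → ℤ) :
    Site.tdist (castSite (A + t) : Site (F.P K) i) (castSite A) ≤ ∑ k, (t k).natAbs := by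
  have e1 : (castSite (A + t) : Site (F.P K) i) =
      castSite A + (show Site (F.P K) i from fun k => ((t k : ℤ) : ZMod ((F.P K).sitesPerDir i))) := by
    funext k; rw [Site.add_apply, castSite_apply, castSite_apply, Pi.add_apply, Int.cast_add]
  rw [e1]
  exact tdist_add_intCast_le' (castSite A) _ t (fun _ => rfl)

end Geometry

end Summit.QuantumFields.YangMills.Theorems.PoincareLipschitzHierAlignT3Geometry

end
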